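import Literature.AlgebraicGeometry.Modules.LocalExactness
import Literature.AlgebraicGeometry.Modules.IsoOfSectionsOnBasis
import Literature.Algebra.Homology.FlatQuasiIsoBaseChange
import Mathlib.Algebra.Homology.HomotopyCategory.MappingCone
import Mathlib.AlgebraicGeometry.AffineScheme
import HarnessLib

/-!
# A chain map of complexes of `𝒪_X`-modules which is a quasi-isomorphism on the sections over a basis of
# opens is a quasi-isomorphism (Hartshorne II Ex. 1.2; Görtz–Wedhorn II Rem. F.85; Stacks 009U)

For a scheme `X`, the **complex of sections over an open `V`** of a cochain complex `M•` of `𝒪_X`-modules is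
`Γ(V, M•) : ⋯ → Γ(Mⁿ, V) → Γ(Mⁿ⁺¹, V) → ⋯` (`sectionsComplexFunctor V`, the termwise extension of the additive
sections functor `sectionsFunctor V : Mod(𝒪_X) ⥤ Ab`, `M ↦ Γ(M, V)`). This file proves the local-to-global
principle used to compare two models of one object of the derived category:

* `exactAt_of_sections_exactAt` — if `Γ(V, C•)` is exact in degree `n` for every `V` in a BASIS of opens, then
  `C•` is exact in degree `n` as a complex of sheaves (a section killed by `d` is locally a boundary;
  `Modules/LocalExactness.exact_of_locally_exact`, i.e. exactness of sheaves is stalk-local, Hartshorne II Ex. 1.2);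
* **`quasiIso_of_quasiIso_sections`** — if `Γ(V, ε) : Γ(V, M•) → Γ(V, K•)` is a quasi-isomorphism for every `V` in
  a basis of opens, then `ε : M• → K•` is a quasi-isomorphism (the mapping cone of `ε` has sections the mapping
  cone of `Γ(V, ε)` — Mathlib `CochainComplex.mappingCone.mapHomologicalComplexIso` — and a chain map is a
  quasi-isomorphism iff its cone is acyclic, `Literature.Algebra.Homology.quasiIso_iff_acyclic_mappingCone`,
  Görtz–Wedhorn II Rem. F.85); `quasiIso_of_quasiIso_sections_affine` — the basis of affine opens.

No converse is claimed (a quasi-isomorphism of complexes of sheaves is NOT a quasi-isomorphism on sections in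
general: `Γ(V, –)` is only left exact). Everything is PROVED; 0 named facts; no instances (the additivity of
`sectionsFunctor V` is the theorem `additive_sectionsFunctor`, bound inside the definition of
`sectionsComplexFunctor`). Typed for the Stage-I comparison «`D⁺_qc(Mod 𝒪_X)` objects are classes of complexes of
quasi-coherent modules» (globalisation of `Modules/TildeGlobalSectionsQuasiIso` along a finite affine cover);
cell `pub-hodge-ring2` — a research route conditional on HC_CM, not a corollary; nothing in this file refers to it.

## References

* R. Hartshorne, *Algebraic Geometry*, GTM 52 (1977), II Prop. 1.1 and Ex. 1.2 (p. 63, 66). [Hartshorne1977]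
* U. Görtz, T. Wedhorn, *Algebraic Geometry II: Cohomology of Schemes*, Springer Spektrum (2023), Rem. F.85,
  Lemma 21.22. [GortzWedhorn2023]
* The Stacks Project, Tag 009U (sheaves and bases). [StacksProject]
-/

noncomputable section

-- `TopCat.Presheaf`/`Scheme.Modules` are not reducible (as in Mathlib's `AlgebraicGeometry/Modules/Sheaf.lean`).
set_option backward.isDefEq.respectTransparency false

open CategoryTheory CategoryTheory.Limits AlgebraicGeometry TopologicalSpace Opposite

universe u

namespace Literature.AlgebraicGeometry.Modules

variable {X : Scheme.{u}}

/-! ## §1 The complex of sections over an open -/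

variable (X) in
/-- The sections functor `M ↦ Γ(M, V)` over an open `V`, with values in abelian groups (Mathlib's
`Scheme.Modules.toPresheaf` evaluated at `V`). [cite: Hartshorne1977, II §1 (p. 61, sheaves of abelian groups)] -/
def sectionsFunctor (V : X.Opens) : X.Modules ⥤ Ab.{u} :=
  Scheme.Modules.toPresheaf X ⋙ (evaluation (X.Opens)ᵒᵖ Ab.{u}).obj (op V)

/-- On objects: `Γ(M, V)`. [cite: Hartshorne1977, II §1 (p. 61, sections of a sheaf)] -/
@[simp]
theorem sectionsFunctor_obj (V : X.Opens) (M : X.Modules) : (sectionsFunctor X V).obj M = Γ(M, V) := rfl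

/-- On morphisms: `φ ↦ φ_V`. [cite: Hartshorne1977, II §1 (p. 62, morphisms of sheaves)] -/
@[simp]
theorem sectionsFunctor_map (V : X.Opens) {M N : X.Modules} (φ : M ⟶ N) :
    (sectionsFunctor X V).map φ = φ.app V := rfl

/-- `Γ(–, V)` is additive (`(φ + ψ)_V = φ_V + ψ_V`). [cite: Hartshorne1977, II §1 (p. 61)] -/
theorem additive_sectionsFunctor (V : X.Opens) : (sectionsFunctor X V).Additive :=
  ⟨fun {_ _ _ _} => rfl⟩

/-- `Γ(–, V)` preserves zero morphisms. [cite: Hartshorne1977, II §1 (p. 61)] -/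
theorem preservesZeroMorphisms_sectionsFunctor (V : X.Opens) : (sectionsFunctor X V).PreservesZeroMorphisms :=
  haveI := additive_sectionsFunctor V
  inferInstance

variable (X) in
/-- **The complex of sections over `V`**: `M• ↦ Γ(V, M•) = (⋯ → Γ(Mⁿ, V) → Γ(Mⁿ⁺¹, V) → ⋯)`, a functor
`C(Mod 𝒪_X) ⥤ C(Ab)` (the termwise extension of `sectionsFunctor`). [cite: Hartshorne1977, III §1 (p. 203, complexes)] -/
def sectionsComplexFunctor (V : X.Opens) : CochainComplex X.Modules ℤ ⥤ CochainComplex Ab.{u} ℤ :=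
  haveI := preservesZeroMorphisms_sectionsFunctor V
  (sectionsFunctor X V).mapHomologicalComplex (ComplexShape.up ℤ)

/-- Terms of the complex of sections `Γ(V, M•)`. [cite: Hartshorne1977, III §1 (p. 203, complexes)] -/
@[simp]
theorem sectionsComplexFunctor_obj_X (V : X.Opens) (M : CochainComplex X.Modules ℤ) (n : ℤ) :
    ((sectionsComplexFunctor X V).obj M).X n = Γ(M.X n, V) := rfl

/-- Differentials of the complex of sections `Γ(V, M•)`. [cite: Hartshorne1977, III §1 (p. 203, complexes)] -/
@[simp]
theorem sectionsComplexFunctor_obj_d (V : X.Opens) (M : CochainComplex X.Modules ℤ) (i j : ℤ) :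
    ((sectionsComplexFunctor X V).obj M).d i j = (M.d i j).app V := rfl

/-- Components of the map of complexes of sections `Γ(V, ε)` induced by a chain map `ε`. [cite: Hartshorne1977, III §1 (p. 203, morphisms of complexes)] -/
@[simp]
theorem sectionsComplexFunctor_map_f (V : X.Opens) {M N : CochainComplex X.Modules ℤ} (ε : M ⟶ N) (n : ℤ) :
    ((sectionsComplexFunctor X V).map ε).f n = (ε.f n).app V := rfl

/-! ## §2 Exactness is tested on the sections over a basis -/

/-- **A complex of `𝒪_X`-modules whose complexes of sections over the members of a basis of opens are exact in
degree `n` is exact in degree `n`** (as a complex of sheaves): a section of `Cⁿ` killed by `d` is, locally, a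
boundary. [cite: Hartshorne1977, II Ex. 1.2 (p. 66)] [cite: StacksProject, Tag 009U] -/
theorem exactAt_of_sections_exactAt {B : Set X.Opens} (hB : Opens.IsBasis B) (C : CochainComplex X.Modules ℤ)
    (n : ℤ) (h : ∀ V ∈ B, ((sectionsComplexFunctor X V).obj C).ExactAt n) : C.ExactAt n := by
  rw [HomologicalComplex.exactAt_iff]
  apply exact_of_locally_exact
  intro W s hs x hx
  obtain ⟨V, hVB, hxV, hVW⟩ := (Opens.isBasis_iff_nbhd.mp hB) hx
  have hV := h V hVB
  rw [HomologicalComplex.exactAt_iff] at hV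
  have hs' : (C.sc n).g.app V ((C.sc n).X₂.presheaf.map (homOfLE hVW).op s) = 0 := by
    erw [app_presheaf_map (C.sc n).g (homOfLE hVW) s, hs, map_zero]
  obtain ⟨t, ht⟩ := ((ShortComplex.ab_exact_iff _).mp hV) _ hs'
  exact ⟨V, homOfLE hVW, hxV, t, ht⟩

/-- The same for acyclicity: exact sections over a basis ⇒ acyclic. [cite: Hartshorne1977, II Ex. 1.2 (p. 66)] -/
theorem acyclic_of_sections_acyclic {B : Set X.Opens} (hB : Opens.IsBasis B) (C : CochainComplex X.Modules ℤ)
    (h : ∀ V ∈ B, ((sectionsComplexFunctor X V).obj C).Acyclic) : C.Acyclic :=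
  fun n => exactAt_of_sections_exactAt hB C n fun V hV => h V hV n

/-! ## §3 Quasi-isomorphisms are tested on the sections over a basis -/

/-- **A chain map of complexes of `𝒪_X`-modules which is a quasi-isomorphism on the sections over every member
of a basis of opens is a quasi-isomorphism.** The cone of `ε` has, over `V`, sections the cone of `Γ(V, ε)`
(Mathlib `mappingCone.mapHomologicalComplexIso` for the additive functor `Γ(–, V)`), which is acyclic; a complex
of sheaves with acyclic sections over a basis is acyclic (§2); and a chain map is a quasi-isomorphism iff its
cone is acyclic. [cite: GortzWedhorn2023, Rem. F.85] [cite: Hartshorne1977, II Ex. 1.2 (p. 66)]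
[cite: StacksProject, Tag 009U] -/
theorem quasiIso_of_quasiIso_sections {B : Set X.Opens} (hB : Opens.IsBasis B) {M K : CochainComplex X.Modules ℤ}
    (ε : M ⟶ K) (h : ∀ V ∈ B, QuasiIso ((sectionsComplexFunctor X V).map ε)) : QuasiIso ε := by
  rw [Literature.Algebra.Homology.quasiIso_iff_acyclic_mappingCone]
  refine acyclic_of_sections_acyclic hB _ fun V hV => ?_
  haveI := additive_sectionsFunctor V
  have hc : (CochainComplex.mappingCone ((sectionsComplexFunctor X V).map ε)).Acyclic :=
    (Literature.Algebra.Homology.quasiIso_iff_acyclic_mappingCone _).1 (h V hV)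
  have e : (sectionsComplexFunctor X V).obj (CochainComplex.mappingCone ε) ≅
      CochainComplex.mappingCone ((sectionsComplexFunctor X V).map ε) :=
    CochainComplex.mappingCone.mapHomologicalComplexIso ε (sectionsFunctor X V)
  exact fun n => (hc n).of_iso e.symm

/-- **Quasi-isomorphisms of complexes of `𝒪_X`-modules are tested on the sections over the affine opens.**
[cite: GortzWedhorn2023, Rem. F.85] [cite: Hartshorne1977, II Ex. 1.2 (p. 66)] [cite: StacksProject, Tag 009U] -/
theorem quasiIso_of_quasiIso_sections_affine {M K : CochainComplex X.Modules ℤ} (ε : M ⟶ K)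
    (h : ∀ ⦃V : X.Opens⦄, IsAffineOpen V → QuasiIso ((sectionsComplexFunctor X V).map ε)) : QuasiIso ε :=
  quasiIso_of_quasiIso_sections X.isBasis_affineOpens ε fun _ hV => h hV

end Literature.AlgebraicGeometry.Modules

end
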